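import Summits.BirchSwinnertonDyer.BirchSwinnertonDyer.Theses.SignedLowerHalves
import Summits.BirchSwinnertonDyer.BirchSwinnertonDyer.Theorems.SignedLowerHalvesKobayashiLowerHalfLargeImageFWLocusCrystalline
import HarnessLib

/-!
# Route `SignedLowerHalves`, crux `KobayashiLowerHalfLargeImage` (item stmt-BirchSwinnertonDyer-19001):
# the line `birth` composed BY NAME — modulo the Fouquet–Wan binder the crux IS its off-locus stub
# (cell `bsd-ssimc`, seat `bsd-ssimc-k3-c3` gen 3; a `--supports … --as helper` file, closes nothing).
# Companions: `…LargeImageUnitZone.lean` (binder-free unit zone; rank-0 slice), `…LargeImageTwistToLocus.lean`.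

PARTITION (cell bsd-ssimc): X7 (A7) × the large-image branch — FW locus (1 004 of the window's 1 417
open X7 pairs) + its complement (277 surj pairs: A 14(+2) BSTW-twist / T 1 / B 150 / C 87 / D 17 / E 6,
MEMO-3 §T) × odd good supersingular `p` — types-the-object-of; closes NONE. THEOREMS ONLY; no
definition, no new named fact; nothing about any curve is asserted; FW stays PRE; BSD is not proved
by any of this.

## What this file records (namespace `Summit.BirchSwinnertonDyer.BirchSwinnertonDyer.Theorems`)

The registered BC3 skeleton of the crux (planner g11, sha16 cce22a86407317b7) cuts
`KobayashiLowerHalfLargeImage` into `stub_fwLocus` (∃ a prime `ℓ ≠ p` of NON-SPLIT multiplicative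
reduction with `p ∤ ord_ℓ Δ_min`) and `stub_offFwLocus` (its negation). `stub_fwLocus` is closed MODULO
the OPEN binder `FouquetWan2021_thm451_via_kobayashi74_OPEN` (`stub_fwLocus_of_thm451_OPEN`, p418661).
Hence, modulo that one binder, THE CRUX IS LITERALLY ITS OFF-LOCUS STUB:
* `offFwLocus_of_kobayashiLowerHalfLargeImage` — crux ⇒ stub (one more hypothesis);
* `kobayashiLowerHalfLargeImage_of_thm451_OPEN_of_offFwLocus` — the skeleton's `KobayashiLowerHalfLargeImage_of`
  with its first `sorry` replaced by the landed helper: FW binder ∧ stub ⇒ crux BY NAME;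
* `kobayashiLowerHalfLargeImage_iff_offFwLocus_of_thm451_OPEN` — under the binder, the crux decl by
  name ⟺ the registered stub signature verbatim.
The honest one-line status of item 3. Off the locus no engine is claimed in print (cell memos MEMO-1
§A, MEMO-3 §T, MEMO-4 §F: 16 pairs PRE-claimed by BSTW's twist clause — p421903 —, 237 «engine-shaped»
under a hybrid nobody prints, 23 shapeless); no binder is typed for it (cell rule r3).

References: [FouquetWan2021] Thm 4.51 / 1.13 (PRE); [Kobayashi2003] Conjecture (p. 2), Thm. 7.4;
[Wuthrich2014] Lemma 20; cell memos k3-c3 MEMO-1 §A, MEMO-3 §T, MEMO-4.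
-/

set_option autoImplicit false
set_option linter.dupNamespace false

noncomputable section

open scoped Classical MatrixGroups ModularForm

open CongruenceSubgroup WeierstrassCurve IsDedekindDomain NumberField Rat.HeightOneSpectrum
  Literature.NumberTheory.EllipticCurves
  Literature.NumberTheory.EllipticCurves.ModularForms
  Literature.NumberTheory.EllipticCurves.Rank1Residual
  Literature.NumberTheory.EllipticCurves.Rank1Residual.Typed
  Literature.NumberTheory.EllipticCurves.Kobayashi2003 ZpExtension
  Summit.BirchSwinnertonDyer.Rank1Residual.Supersingular

namespace Summit.BirchSwinnertonDyer.BirchSwinnertonDyer.Theorems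

/-! ### §1 The line `birth` composed BY NAME -/

section Composition

open Summit.BirchSwinnertonDyer.BirchSwinnertonDyer.Theses.SignedLowerHalves

/-- **The crux implies its off-locus stub** (trivially: the stub is the crux with one more hypothesis).
The conclusion is the registered signature of `stub_offFwLocus` VERBATIM.
[cite: Kobayashi2003, Conjecture (Main Conjecture) (p. 2)] -/
theorem offFwLocus_of_kobayashiLowerHalfLargeImage (h : KobayashiLowerHalfLargeImage) :
    ∀ (W : WeierstrassCurve ℚ) [W.IsElliptic] [W.IsGloballyMinimal] (p : ℕ) [Fact p.Prime],
      p ≠ 2 → ClassX7 W p → ¬ W.HasCM → W.frobeniusTrace p = 0 → Surj W p →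
      ¬ (∃ ℓ : ℕ, ∃ _ : Fact ℓ.Prime, ℓ ≠ p ∧ W.HasMultiplicativeReductionAtPrime ℓ ∧
          ¬ W.HasSplitMultiplicativeReductionAtPrime ℓ ∧ ¬ p ∣ padicValInt ℓ W.minimalDiscriminantInt) →
      ∃ ε : ℤˣ, Summit.BirchSwinnertonDyer.Rank1Residual.Supersingular.KobayashiLowerDivisibility W p ε := by
  intro W _ _ p _ hp hX hcm hap hs _hoff
  unfold KobayashiLowerHalfLargeImage at h
  exact h W p hp hX hcm hap hs

/-- **The line `birth`, composed BY NAME: crux ⟸ FW binder ∧ `stub_offFwLocus`.** IF the OPEN binder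
`FouquetWan2021_thm451_via_kobayashi74_OPEN` holds (`hFW`, Fouquet–Wan arXiv:2107.13726 Thm 4.51 read
through Kobayashi Thm 7.4; UNREFEREED) and the registered stub `stub_offFwLocus` holds (`hoff`, its
signature VERBATIM), then the crux `KobayashiLowerHalfLargeImage` holds: case on the locus hypothesis,
on-locus by `stub_fwLocus_of_thm451_OPEN` (p418661), off-locus by `hoff`. This is the skeleton's
`KobayashiLowerHalfLargeImage_of` with its first `sorry` replaced by the landed helper. CONDITIONAL;
closes nothing. [claim: FouquetWan2021, status: under-review]
[cite: Kobayashi2003, Thm. 7.4 (p. 13) and Conjecture (p. 2)] -/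
theorem kobayashiLowerHalfLargeImage_of_thm451_OPEN_of_offFwLocus
    (hFW : FouquetWan2021_thm451_via_kobayashi74_OPEN)
    (hoff : ∀ (W : WeierstrassCurve ℚ) [W.IsElliptic] [W.IsGloballyMinimal] (p : ℕ) [Fact p.Prime],
      p ≠ 2 → ClassX7 W p → ¬ W.HasCM → W.frobeniusTrace p = 0 → Surj W p →
      ¬ (∃ ℓ : ℕ, ∃ _ : Fact ℓ.Prime, ℓ ≠ p ∧ W.HasMultiplicativeReductionAtPrime ℓ ∧
          ¬ W.HasSplitMultiplicativeReductionAtPrime ℓ ∧ ¬ p ∣ padicValInt ℓ W.minimalDiscriminantInt) →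
      ∃ ε : ℤˣ, Summit.BirchSwinnertonDyer.Rank1Residual.Supersingular.KobayashiLowerDivisibility W p ε) :
    KobayashiLowerHalfLargeImage := by
  unfold KobayashiLowerHalfLargeImage
  intro W _ _ p _ hp hX hcm hap hs
  by_cases hloc : ∃ ℓ : ℕ, ∃ _ : Fact ℓ.Prime, ℓ ≠ p ∧ W.HasMultiplicativeReductionAtPrime ℓ ∧
      ¬ W.HasSplitMultiplicativeReductionAtPrime ℓ ∧ ¬ p ∣ padicValInt ℓ W.minimalDiscriminantInt
  · exact stub_fwLocus_of_thm451_OPEN hFW W p hp hX hcm hap hs hloc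
  · exact hoff W p hp hX hcm hap hs hloc

/-- **Modulo the Fouquet–Wan binder, item 3 IS its off-locus stub**: under
`FouquetWan2021_thm451_via_kobayashi74_OPEN` (UNREFEREED), `KobayashiLowerHalfLargeImage` (the crux decl
by name) is EQUIVALENT to the registered signature of `stub_offFwLocus`. CONDITIONAL; closes nothing;
the honest one-line status of the item. [claim: FouquetWan2021, status: under-review]
[cite: Kobayashi2003, Conjecture (Main Conjecture) (p. 2)] -/
theorem kobayashiLowerHalfLargeImage_iff_offFwLocus_of_thm451_OPEN
    (hFW : FouquetWan2021_thm451_via_kobayashi74_OPEN) :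
    KobayashiLowerHalfLargeImage ↔
    ∀ (W : WeierstrassCurve ℚ) [W.IsElliptic] [W.IsGloballyMinimal] (p : ℕ) [Fact p.Prime],
      p ≠ 2 → ClassX7 W p → ¬ W.HasCM → W.frobeniusTrace p = 0 → Surj W p →
      ¬ (∃ ℓ : ℕ, ∃ _ : Fact ℓ.Prime, ℓ ≠ p ∧ W.HasMultiplicativeReductionAtPrime ℓ ∧
          ¬ W.HasSplitMultiplicativeReductionAtPrime ℓ ∧ ¬ p ∣ padicValInt ℓ W.minimalDiscriminantInt) →
      ∃ ε : ℤˣ, Summit.BirchSwinnertonDyer.Rank1Residual.Supersingular.KobayashiLowerDivisibility W p ε :=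
  ⟨fun h W _ _ p _ ↦ offFwLocus_of_kobayashiLowerHalfLargeImage h W p,
    kobayashiLowerHalfLargeImage_of_thm451_OPEN_of_offFwLocus hFW⟩

end Composition

end Summit.BirchSwinnertonDyer.BirchSwinnertonDyer.Theorems

end
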